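import Literature.NumberTheory.LFunctions.KadiriNumericsRound1C
import Literature.NumberTheory.LFunctions.KadiriNumericsRound2C
import Literature.NumberTheory.LFunctions.KadiriNumericsRound3C
import Literature.NumberTheory.LFunctions.KadiriNumericsRound4C
import HarnessLib

/-!
# Theorem 1 of Mossinghoff–Trudgian 2015 from the numerical verification of RH alone: assembly of the certified rounds

Topic `Literature/NumberTheory/LFunctions`. Pure proof file for **(B₀)**, Theorem 1 of
M. J. Mossinghoff, T. S. Trudgian, *Nonnegative trigonometric polynomials and a zero-free region
for the Riemann zeta-function*, J. Number Theory **157** (2015) 329–349 = arXiv:1410.3926: "There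
are no zeros of `ζ(σ + it)` for `|t| ≥ 2` and `σ > 1 − 1/(5.573412 log|t|)`" (the input region
`R = 5.573412` of the iteration of Mossinghoff–Trudgian–Yang 2024, §9, behind the named fact
`zero_free_region_mossinghoff_trudgian_yang` of `RHWave0.lean` / `ExplicitZeroFreeRegion.lean`).
Nothing is asserted here: no definition, no named fact. Since this file PROVES (B₀) from leaf (A)
alone, (B₀) is not a named fact of the tree (D-0026 review of the decomposition of Thm. 1.3,
2026-08-15): the theorem below states it verbatim, and its open-region spelling is
`HasOpenClassicalZeroFreeRegion 5.573412` (`ExplicitZeroFreeRegionKernel.lean`).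

## What is proved

(B₀) **conditional only on leaf (A)** `platt_trudgian_numerical_rh` (Platt–Trudgian 2021, RH up to
height `3 000 175 332 800`; a certified computation and a permanent leaf of the tree's trust base,
`RHWave0NumericalRHProofs.lean`):

* `zero_free_region_mossinghoff_trudgian_2015_of_numerical_rh : platt_trudgian_numerical_rh →
  ∀ σ t : ℝ, 2 ≤ |t| → 1 - 1 / (5.573412 * Real.log |t|) < σ → riemannZeta (σ + t * I) ≠ 0`,

together with the named intermediate regions from (A) — the open anchor `R = 7062` and the CLOSED
classical regions `R = 6.4, 5.66, 5.57` and, one round further, `R = 5.558691`, i.e. Theorem 1.3 of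
Mossinghoff–Trudgian–Yang at all heights `|t| ≥ 2` from (A) alone
(`zero_free_region_mossinghoff_trudgian_yang_of_numerical_rh_only`). The engine's own assembly
(sibling file `KadiriNumericsFinal.lean`, same imports) runs the same four rounds in the open-region
form to the large-height leaf (B) (`zero_free_region_mossinghoff_trudgian_yang_large_height_of_numerical_rh`);
this file gives the closed regions, Theorem 1 of Mossinghoff–Trudgian and Theorem 1.3 in full.

## How (the printed architecture, §§2–3 and §5 of the source, as realised in the tree)

Every analytic ingredient is PROVED elsewhere in the tree and only assembled here:

1. *Small heights.* For `2 ≤ |t| ≤ 3 000 175 332 800` the region is read off (A)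
   (`HasClassicalZeroFreeRegion.of_kadiriStripEmpty`, `ExplicitZeroFreeRegionKernel.lean`; the source
   uses Platt's verification of RH to height `3.06·10¹⁰` at this point, §§1, 3).
2. *The anchor.* The tree's crude explicit region `1 − β ≥ 1/((4480 + 74172/log T) log|t|)`
   (`ZetaZeroFreeRegionExplicit.lean`) and (A) give the open classical region with constant `7062`
   (`KadiriStrip.hasOpenRegion_initial`, `KadiriStripEmptiness.lean`; here
   `hasOpenClassicalZeroFreeRegion_7062_of_numerical_rh`: `log H ≥ log(3·10¹²) ≥ 28.7296`, so
   `4480 + 74172/log H ≤ 7061.8 ≤ 7062`, as in `KadiriNumerics.initial_constant_le` of the sibling file).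
3. *The rounds.* Kadiri's method with the sixteen-term polynomial and the refined splitting of
   Mossinghoff–Trudgian ((2.2), (3.1), §4 of the source; engine `KadiriStrip.strip_empty`) empties the
   strips `1 − 1/(r log γ) ≤ β ≤ 1 − 1/(R log γ)`, `γ > 3·10¹²`, for
   `(R, r) = (7062, 6.4), (6.4, 5.66), (5.66, 5.57), (5.57, 5.558691)`; the numerical side conditions
   of each round are the interval-arithmetic certificates `KadiriNumerics.round_round1` … `round_round4`
   (`KadiriNumericsRound{1,2,3,4}{A,B,C}.lean`, checked by `norm_num`/`linarith` in the kernel, no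
   `native_decide`). Each round consumes the region produced by the previous one
   (`HasClassicalZeroFreeRegion.of_kadiriStripEmpty` again, which also re-covers the small heights by (A)).
4. *Monotonicity.* `5.57 ≤ 5.573412`, so the closed region with constant `5.57` contains the printed
   one (`HasClassicalZeroFreeRegion.mono`, `zero_free_region_mossinghoff_trudgian_2015_of_hasClassicalZeroFreeRegion`).

The source runs seven rounds from `R = 5.7` (Kadiri's `5.69693`) at `T₀ = 3.06·10¹⁰` with
`θ = 1.85573`, `t₀ = 10⁵` (§3: "We obtain the value `R₀ = 5.5734118005…` after seven rounds"); the
tree runs four rounds at `T₀ = 3·10¹²` with the Mossinghoff–Trudgian–Yang parameters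
(`θ₀ = 1.13331020`, `t₀ = 10⁸`), which pass the printed constant `5.573412` at the third round. The
statement proved is Theorem 1 verbatim; only the unconditional closing of leaf (A) (a
`1.2·10¹³`-zero computation) is out of reach of the kernel, so (B₀) stays conditional on (A).

## References

* M. J. Mossinghoff, T. S. Trudgian, J. Number Theory 157 (2015) 329–349, Theorem 1, (2.2), (3.1),
  §§4–5. [MossinghoffTrudgian2015]
* M. J. Mossinghoff, T. S. Trudgian, A. Yang, *Explicit zero-free regions for the Riemann
  zeta-function*, Res. Number Theory 10 (2024) = arXiv:2212.06867, Theorem 1.3, §9.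
  [MossinghoffTrudgianYangRNT2024]
* H. Kadiri, *Une région explicite sans zéros pour la fonction ζ de Riemann*, Acta Arith. 117 (2005)
  303–339, §§2–4. [Kadiri2005]
* D. J. Platt, T. S. Trudgian, *The Riemann hypothesis is true up to 3·10¹²*, Bull. Lond. Math. Soc.
  53 (2021) 792–797, Theorem 1. [PlattTrudgian2021]
-/

noncomputable section

open Real

namespace Literature.NumberTheory.LFunctions

/-! ## The anchor `R = 7062` from leaf (A) -/

/-- **The anchor of the iteration from leaf (A):** the open classical region with constant `7062`
(the crude explicit region `4480 + 74172/log H`, `H = 3 000 175 332 800`, has constant `≤ 7062` since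
`log H ≥ log(3·10¹²) ≥ 28.7296` by the tree's enclosures of `log 2, log 3, log 5`; below `H` the region
holds by (A); `KadiriStrip.hasOpenRegion_initial`). [cite: MossinghoffTrudgian2015, §2] -/
theorem hasOpenClassicalZeroFreeRegion_7062_of_numerical_rh (hA : platt_trudgian_numerical_rh) :
    HasOpenClassicalZeroFreeRegion 7062 := by
  refine KadiriStrip.hasOpenRegion_initial (H := 3000175332800) (by norm_num) ?_
    (KadiriStrip.rh_up_to_of_numerical_rh hA)
  -- `4480 + 74172 / log H ≤ 7062`
  have hl2a := Real.log_two_gt_d9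
  have hl3 := KadiriNumerics.log_3_bounds
  have hl5 := KadiriNumerics.log_5_bounds
  have hT : Real.log (3 * 10 ^ 12) = Real.log 3 + 12 * (Real.log 2 + Real.log 5) := by
    rw [Real.log_mul (by norm_num) (by norm_num), Real.log_pow, show (10 : ℝ) = 2 * 5 by norm_num,
      Real.log_mul (by norm_num) (by norm_num)]; push_cast; ring
  have hlow : (28.729633401 : ℝ) ≤ Real.log 3000175332800 := by
    refine le_trans ?_ (Real.log_le_log (by norm_num) (by norm_num : (3 * 10 ^ 12 : ℝ) ≤ 3000175332800))
    rw [hT]; linarith [hl3.1, hl5.1]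
  have h1 : 74172 / Real.log 3000175332800 ≤ 74172 / 28.729633401 :=
    div_le_div_of_nonneg_left (by norm_num) (by norm_num) hlow
  have h2 : (74172 / 28.729633401 : ℝ) ≤ 2582 := by norm_num
  linarith

/-! ## The four certified rounds at `T₀ = 3·10¹²` -/

/-- `3·10¹² ≤ 3 000 175 332 800` (the rounds' `T₀` is below the height of (A)). [folklore] -/
theorem three_mul_ten_pow_twelve_le_plattTrudgianHeight : (3 * 10 ^ 12 : ℝ) ≤ 3000175332800 := by
  norm_num

/-- **Round 1, `7062 → 6.4`:** the closed classical region with constant `6.4`, from (A).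
[cite: MossinghoffTrudgian2015, §2 and §5] -/
theorem hasClassicalZeroFreeRegion_6_4_of_numerical_rh (hA : platt_trudgian_numerical_rh) :
    HasClassicalZeroFreeRegion 6.4 :=
  HasClassicalZeroFreeRegion.of_kadiriStripEmpty hA three_mul_ten_pow_twelve_le_plattTrudgianHeight
    (hasOpenClassicalZeroFreeRegion_7062_of_numerical_rh hA)
    (KadiriNumerics.round_round1 (hasOpenClassicalZeroFreeRegion_7062_of_numerical_rh hA)
      (KadiriStrip.rh_up_to_of_numerical_rh hA)) (by norm_num)

/-- **Round 2, `6.4 → 5.66`:** the closed classical region with constant `5.66`, from (A).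
[cite: MossinghoffTrudgian2015, §2 and §5] -/
theorem hasClassicalZeroFreeRegion_5_66_of_numerical_rh (hA : platt_trudgian_numerical_rh) :
    HasClassicalZeroFreeRegion 5.66 :=
  HasClassicalZeroFreeRegion.of_kadiriStripEmpty hA three_mul_ten_pow_twelve_le_plattTrudgianHeight
    (hasClassicalZeroFreeRegion_6_4_of_numerical_rh hA).hasOpen
    (KadiriNumerics.round_round2 (hasClassicalZeroFreeRegion_6_4_of_numerical_rh hA).hasOpen
      (KadiriStrip.rh_up_to_of_numerical_rh hA)) (by norm_num)

/-- **Round 3, `5.66 → 5.57`:** the closed classical region with constant `5.57`, from (A). This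
round already passes the printed constant `5.573412` of Theorem 1. [cite: MossinghoffTrudgian2015, §2 and §5] -/
theorem hasClassicalZeroFreeRegion_5_57_of_numerical_rh (hA : platt_trudgian_numerical_rh) :
    HasClassicalZeroFreeRegion 5.57 :=
  HasClassicalZeroFreeRegion.of_kadiriStripEmpty hA three_mul_ten_pow_twelve_le_plattTrudgianHeight
    (hasClassicalZeroFreeRegion_5_66_of_numerical_rh hA).hasOpen
    (KadiriNumerics.round_round3 (hasClassicalZeroFreeRegion_5_66_of_numerical_rh hA).hasOpen
      (KadiriStrip.rh_up_to_of_numerical_rh hA)) (by norm_num)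

/-- **Round 4, `5.57 → 5.558691`:** the closed classical region with the constant of
Mossinghoff–Trudgian–Yang, from (A). [cite: MossinghoffTrudgianYangRNT2024, Theorem 1.3 and §9] -/
theorem hasClassicalZeroFreeRegion_5_558691_of_numerical_rh (hA : platt_trudgian_numerical_rh) :
    HasClassicalZeroFreeRegion 5.558691 :=
  HasClassicalZeroFreeRegion.of_kadiriStripEmpty hA three_mul_ten_pow_twelve_le_plattTrudgianHeight
    (hasClassicalZeroFreeRegion_5_57_of_numerical_rh hA).hasOpen
    (KadiriNumerics.round_round4 (hasClassicalZeroFreeRegion_5_57_of_numerical_rh hA).hasOpen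
      (KadiriStrip.rh_up_to_of_numerical_rh hA)) (by norm_num)

/-! ## Theorem 1 of Mossinghoff–Trudgian (and Theorem 1.3 of Mossinghoff–Trudgian–Yang) from leaf (A) -/

/-- **Theorem 1 of Mossinghoff–Trudgian 2015 from the numerical verification of RH alone:**
leaf (A) `platt_trudgian_numerical_rh` implies that `ζ(σ + it) ≠ 0` for `|t| ≥ 2` and
`σ > 1 − 1/(5.573412 log|t|)` — by the anchor `7062`, the three certified rounds
`7062 → 6.4 → 5.66 → 5.57` of Kadiri's method at `T₀ = 3·10¹²`, and `5.57 ≤ 5.573412`. The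
statement is Theorem 1 of the source verbatim ((B₀)); this is its proof modulo the computational
leaf (A) only. [cite: MossinghoffTrudgian2015, Theorem 1] -/
theorem zero_free_region_mossinghoff_trudgian_2015_of_numerical_rh (hA : platt_trudgian_numerical_rh) :
    ∀ σ t : ℝ, 2 ≤ |t| → 1 - 1 / (5.573412 * Real.log |t|) < σ →
      riemannZeta (σ + t * Complex.I) ≠ 0 :=
  zero_free_region_mossinghoff_trudgian_2015_of_hasClassicalZeroFreeRegion
    ((hasClassicalZeroFreeRegion_5_57_of_numerical_rh hA).mono (by norm_num) (by norm_num))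

/-- The same in the open-region spelling `HasOpenClassicalZeroFreeRegion 5.573412`.
[cite: MossinghoffTrudgian2015, Theorem 1] -/
theorem hasOpenClassicalZeroFreeRegion_mossinghoff_trudgian_2015_of_numerical_rh
    (hA : platt_trudgian_numerical_rh) : HasOpenClassicalZeroFreeRegion 5.573412 :=
  zero_free_region_mossinghoff_trudgian_2015_of_numerical_rh hA

/-- **Theorem 1.3 of Mossinghoff–Trudgian–Yang from leaf (A) alone** (four rounds, the last one
`5.57 → 5.558691`): no zeros of `ζ(σ + it)` for `|t| ≥ 2`, `σ ≥ 1 − 1/(5.558691 log|t|)`.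
[cite: MossinghoffTrudgianYangRNT2024, Theorem 1.3] -/
theorem zero_free_region_mossinghoff_trudgian_yang_of_numerical_rh_only
    (hA : platt_trudgian_numerical_rh) : zero_free_region_mossinghoff_trudgian_yang :=
  hasClassicalZeroFreeRegion_iff_mossinghoff_trudgian_yang.1
    (hasClassicalZeroFreeRegion_5_558691_of_numerical_rh hA)

end Literature.NumberTheory.LFunctions
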